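import Mathlib
import HarnessLib.Audit
import Summits.PneNP.PneNP.Theorems.PstarMultiSiblingKill

/-!
# The member with several siblings (III): the kill in JOIN FORM (ROUND-24, O1; memo g29 §83)

FRONTIER range-avoidance ladder, rung F-N3, ROUND 24 (cell `pnp-ideate`, prover-2 memo `g29/O1-SIBLINGS-g29.md` §83; census node
`PstarLocalGateBudgetAssembly.LocalMenuCriterionBoundGateBudget`; restricted-model proof complexity — nothing here bears on `P` versus `NP`).

`PstarMultiSiblingKill.false_of_multi_sibling` carries two SEMANTIC side conditions — the idle set `A₁ = A ∩ {x_σ = 0}` is non-empty, and every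
off-block `Γ₂`-gate partner `u` of a block variable is FROZEN on `Ā` or THAWED in `A₁`.  As in g28 §76 (`PstarMemberKillJoins`, one sibling) both
are JOIN ENUMERATIONS, decidable from incidence data and `(y, b₁)`:

* `exists_idle_of_joins` — typed instance, `C₁` off the AND variables of `K ∪ G₁`, privacy on `K ∪ G₁`: if no join all of whose members (and folds)
  pass through `σ` has value `1`, then `A₁ ≠ ∅` (`PstarMemberKillJoins.exists_false_of_no_dead_join_singleton`);
* `partners_of_joins` — a partner `u` with a one-block value-`1` join through `u` inside `K ∖ e` is frozen (`frozen_of_block_join`); a partner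
  `u ∉ C₁`, no XOR variable, with a pattern `Z ∋ σ` containing its `K ∪ G₁`-partners, off `C₁` and the XOR slots, with no dead value-`1` join, is
  thawed in `A₁` (`thawed_of_no_dead_join`);
* **`false_of_multi_sibling_joins`**, **`not_terminal_of_multi_sibling_joins`**, **`not_terminalNC_of_multi_sibling_joins`** — the kill with the
  semantic conditions replaced by these join lists: the census check for a member whose literal has ANY number of siblings in `K ∪ F₁`
  (g28 §80 step 3 without the `hσonly` proviso of §80.4).
-/

set_option linter.dupNamespace false -- `Summit.PneNP.PneNP.…`: summit = sub-problem name (D-0017 single-conjunct layout)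

open Finset Literature.Computability.Complexity
open Summit.PneNP.PneNP.Theorems.PstarTyped (Typed)
open Summit.PneNP.PneNP.Theorems.PstarCoreBoundTargets (Terminal)
open Summit.PneNP.PneNP.Theorems.PstarUnion (SatPair)
open Summit.PneNP.PneNP.Theorems.PstarUnionCovers (TerminalNC)
open Summit.PneNP.PneNP.Theorems.PstarLiteralPinning (Through InSlice IsJoin joinValue)
open Summit.PneNP.PneNP.Theorems.PstarDeadPatterns (Dead)
open Summit.PneNP.PneNP.Theorems.PstarDirtyMemberSquare (InSliceBut)
open Summit.PneNP.PneNP.Theorems.PstarMemberKillJoins (frozen_of_block_join thawed_of_no_dead_join exists_false_of_no_dead_join_singleton)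
open Summit.PneNP.PneNP.Theorems.PstarMultiSiblingSquare (Setup)
open Summit.PneNP.PneNP.Theorems.PstarMultiSiblingKill (false_of_multi_sibling)

namespace Summit.PneNP.PneNP.Theorems.PstarMultiSiblingJoins

variable {n m : ℕ} {I : LocalMap 4 n m} {y : Fin m → Bool} {K : Finset (Fin m)} {w₁ w₂ : Finset (Fin n) × Finset (Fin m) × Bool}
  {e : Fin m} {σ p : Fin n} {S : Finset (Fin m)} {q : Fin m → Fin n}

/-- **Idle point from the join condition on the pattern `{σ}`.**  Typed; `C₁` off the AND variables of `K ∪ G₁`; privacy; no join through `σ`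
(members and, if it uses the reader, folds) of value `1` ⇒ `A₁ ≠ ∅`. -/
theorem exists_idle_of_joins (H : Setup I K w₁ w₂ e σ p S q) (hT : Typed I)
    (hC₁ : ∀ v ∈ w₁.1, ∀ j ∈ K ∪ w₁.2.1, ¬ Through I v j)
    (hpriv : ∀ j ∈ K ∪ w₁.2.1, ∃ a, Through I a j ∧ ∀ j' ∈ K ∪ w₁.2.1, Through I a j' → j' = j)
    (hidle : ∀ D ⊆ K, ∀ t : Bool, IsJoin I w₁.1 D t → (∀ j ∈ D, Through I σ j) → (t = true → ∀ g ∈ w₁.2.1, Through I σ g) →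
      joinValue y w₁.2.2 D t ≠ 1) :
    ∃ z, InSlice I y K w₁ z ∧ z σ = false := by
  haveI : Nonempty (Fin n) := ⟨σ⟩
  exact exists_false_of_no_dead_join_singleton H.pure hT H.hKG hC₁ (fun j hj => ⟨(H.hX j hj).1, (H.hX j hj).2.1⟩) H.hC₁.1
    (fun j hj _ => hpriv j hj) hidle

/-- **Frozen-or-thawed partners from the join conditions.**  For each off-block `Γ₂`-gate partner `u` of a block variable: EITHER a one-block
value-`1` join through `u` inside `K ∖ e` (then `u` is frozen on `Ā`), OR `u ∉ C₁`, `u` no XOR variable of `K`, and a pattern `Z ∋ σ` of variables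
off `C₁` and the XOR slots containing the `K ∪ G₁`-partners of `u`, with no dead join of value `1` (then `u` is thawed in `A₁`). -/
theorem partners_of_joins (H : Setup I K w₁ w₂ e σ p S q) (hT : Typed I)
    (hC₁ : ∀ v ∈ w₁.1, ∀ j ∈ K ∪ w₁.2.1, ¬ Through I v j)
    (hpriv : ∀ j ∈ K ∪ w₁.2.1, ∃ a, Through I a j ∧ ∀ j' ∈ K ∪ w₁.2.1, Through I a j' → j' = j)
    (hpart : ∀ g ∈ w₂.2.1, ∀ u v : Fin n, (v = p ∨ v = σ ∨ ∃ o ∈ S, v = q o) →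
      ((I.vars g 2 = v ∧ I.vars g 3 = u) ∨ (I.vars g 2 = u ∧ I.vars g 3 = v)) → u ≠ p → u ≠ σ → (∀ o ∈ S, u ≠ q o) →
      (∃ D ⊆ K.erase e, ∃ t : Bool, IsJoin I w₁.1 D t ∧ (∀ j ∈ D, Through I u j) ∧ (t = true → ∀ g' ∈ w₁.2.1, Through I u g') ∧
          joinValue y w₁.2.2 D t = 1) ∨
      (u ∉ w₁.1 ∧ (∀ j ∈ K, I.vars j 0 ≠ u ∧ I.vars j 1 ≠ u) ∧
        ∃ Z : Finset (Fin n), σ ∈ Z ∧ (∀ j ∈ K ∪ w₁.2.1, (I.vars j 2 = u → I.vars j 3 ∈ Z) ∧ (I.vars j 3 = u → I.vars j 2 ∈ Z)) ∧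
          (∀ w ∈ Z, ∀ j ∈ K, I.vars j 0 ≠ w ∧ I.vars j 1 ≠ w) ∧ (∀ w ∈ Z, w ∉ w₁.1) ∧
          ∀ D ⊆ K, ∀ t : Bool, IsJoin I w₁.1 D t → (∀ j ∈ D, Dead I Z j) → (t = true → ∀ g' ∈ w₁.2.1, Dead I Z g') →
            joinValue y w₁.2.2 D t ≠ 1)) :
    ∀ g ∈ w₂.2.1, ∀ u v : Fin n, (v = p ∨ v = σ ∨ ∃ o ∈ S, v = q o) →
      ((I.vars g 2 = v ∧ I.vars g 3 = u) ∨ (I.vars g 2 = u ∧ I.vars g 3 = v)) → u ≠ p → u ≠ σ → (∀ o ∈ S, u ≠ q o) →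
      (∀ x x' : Fin n → Bool, InSliceBut I y K e w₁ x → InSliceBut I y K e w₁ x' → x u = x' u) ∨
      (∃ z, (InSlice I y K w₁ z ∧ z σ = false) ∧ InSlice I y K w₁ (Function.update z u (!z u))) := by
  intro g hg u v hv hgs hup huσ huq
  rcases hpart g hg u v hv hgs hup huσ huq with ⟨D, hD, t, hJ, hDu, hGu, hval⟩ | ⟨huC, huX, Z, hσZ, huZ, hZX, hZC, hnoZ⟩
  · exact Or.inl (frozen_of_block_join H.pure hD hJ hDu hGu hval)
  · haveI : Nonempty (Fin n) := ⟨u⟩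
    exact Or.inr (thawed_of_no_dead_join H.pure hT H.hKG hC₁ hZX hZC (fun j hj _ => hpriv j hj) hnoZ hσZ huZ huC huX)

/-- **(T3) + (M0) AT A MULTI-SIBLING MEMBER IS CONTRADICTORY — JOIN FORM.**  Typed; simple overlaps among the monomials of `Γ₂`; `C₁` off the AND
variables of `K ∪ G₁`; privacy on `K ∪ G₁`; (idle) no join through `σ` of value `1`; (partners) every off-block gate partner of a block variable
pinned by a one-block value-`1` join avoiding `e`, or thawable by a pattern `Z ∋ σ` ⊇ its partners with no dead value-`1` join. -/
theorem false_of_multi_sibling_joins (H : Setup I K w₁ w₂ e σ p S q) (hT : Typed I)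
    (hSG : ∀ g ∈ w₂.2.1, ∀ g' ∈ w₂.2.1, g' ≠ g → ¬ ((I.vars g' 2 = I.vars g 2 ∧ I.vars g' 3 = I.vars g 3) ∨
      (I.vars g' 2 = I.vars g 3 ∧ I.vars g' 3 = I.vars g 2)))
    (hC₁ : ∀ v ∈ w₁.1, ∀ j ∈ K ∪ w₁.2.1, ¬ Through I v j)
    (hpriv : ∀ j ∈ K ∪ w₁.2.1, ∃ a, Through I a j ∧ ∀ j' ∈ K ∪ w₁.2.1, Through I a j' → j' = j)
    (hidle : ∀ D ⊆ K, ∀ t : Bool, IsJoin I w₁.1 D t → (∀ j ∈ D, Through I σ j) → (t = true → ∀ g ∈ w₁.2.1, Through I σ g) →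
      joinValue y w₁.2.2 D t ≠ 1)
    (hpart : ∀ g ∈ w₂.2.1, ∀ u v : Fin n, (v = p ∨ v = σ ∨ ∃ o ∈ S, v = q o) →
      ((I.vars g 2 = v ∧ I.vars g 3 = u) ∨ (I.vars g 2 = u ∧ I.vars g 3 = v)) → u ≠ p → u ≠ σ → (∀ o ∈ S, u ≠ q o) →
      (∃ D ⊆ K.erase e, ∃ t : Bool, IsJoin I w₁.1 D t ∧ (∀ j ∈ D, Through I u j) ∧ (t = true → ∀ g' ∈ w₁.2.1, Through I u g') ∧
          joinValue y w₁.2.2 D t = 1) ∨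
      (u ∉ w₁.1 ∧ (∀ j ∈ K, I.vars j 0 ≠ u ∧ I.vars j 1 ≠ u) ∧
        ∃ Z : Finset (Fin n), σ ∈ Z ∧ (∀ j ∈ K ∪ w₁.2.1, (I.vars j 2 = u → I.vars j 3 ∈ Z) ∧ (I.vars j 3 = u → I.vars j 2 ∈ Z)) ∧
          (∀ w ∈ Z, ∀ j ∈ K, I.vars j 0 ≠ w ∧ I.vars j 1 ≠ w) ∧ (∀ w ∈ Z, w ∉ w₁.1) ∧
          ∀ D ⊆ K, ∀ t : Bool, IsJoin I w₁.1 D t → (∀ j ∈ D, Dead I Z j) → (t = true → ∀ g' ∈ w₁.2.1, Dead I Z g') →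
            joinValue y w₁.2.2 D t ≠ 1))
    (hT3 : ¬ SatPair I y K w₁ w₂) (hM0 : SatPair I y (K.erase e) w₁ w₂) : False :=
  false_of_multi_sibling H hSG (exists_idle_of_joins H hT hC₁ hpriv hidle) (partners_of_joins H hT hC₁ hpriv hpart) hT3 hM0

/-- **THE MULTI-SIBLING KILL, JOIN FORM — `Terminal`.** -/
theorem not_terminal_of_multi_sibling_joins {r : ℕ} (H : Setup I K w₁ w₂ e σ p S q) (hT : Typed I)
    (hSG : ∀ g ∈ w₂.2.1, ∀ g' ∈ w₂.2.1, g' ≠ g → ¬ ((I.vars g' 2 = I.vars g 2 ∧ I.vars g' 3 = I.vars g 3) ∨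
      (I.vars g' 2 = I.vars g 3 ∧ I.vars g' 3 = I.vars g 2)))
    (hC₁ : ∀ v ∈ w₁.1, ∀ j ∈ K ∪ w₁.2.1, ¬ Through I v j)
    (hpriv : ∀ j ∈ K ∪ w₁.2.1, ∃ a, Through I a j ∧ ∀ j' ∈ K ∪ w₁.2.1, Through I a j' → j' = j)
    (hidle : ∀ D ⊆ K, ∀ t : Bool, IsJoin I w₁.1 D t → (∀ j ∈ D, Through I σ j) → (t = true → ∀ g ∈ w₁.2.1, Through I σ g) →
      joinValue y w₁.2.2 D t ≠ 1)
    (hpart : ∀ g ∈ w₂.2.1, ∀ u v : Fin n, (v = p ∨ v = σ ∨ ∃ o ∈ S, v = q o) →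
      ((I.vars g 2 = v ∧ I.vars g 3 = u) ∨ (I.vars g 2 = u ∧ I.vars g 3 = v)) → u ≠ p → u ≠ σ → (∀ o ∈ S, u ≠ q o) →
      (∃ D ⊆ K.erase e, ∃ t : Bool, IsJoin I w₁.1 D t ∧ (∀ j ∈ D, Through I u j) ∧ (t = true → ∀ g' ∈ w₁.2.1, Through I u g') ∧
          joinValue y w₁.2.2 D t = 1) ∨
      (u ∉ w₁.1 ∧ (∀ j ∈ K, I.vars j 0 ≠ u ∧ I.vars j 1 ≠ u) ∧
        ∃ Z : Finset (Fin n), σ ∈ Z ∧ (∀ j ∈ K ∪ w₁.2.1, (I.vars j 2 = u → I.vars j 3 ∈ Z) ∧ (I.vars j 3 = u → I.vars j 2 ∈ Z)) ∧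
          (∀ w ∈ Z, ∀ j ∈ K, I.vars j 0 ≠ w ∧ I.vars j 1 ≠ w) ∧ (∀ w ∈ Z, w ∉ w₁.1) ∧
          ∀ D ⊆ K, ∀ t : Bool, IsJoin I w₁.1 D t → (∀ j ∈ D, Dead I Z j) → (t = true → ∀ g' ∈ w₁.2.1, Dead I Z g') →
            joinValue y w₁.2.2 D t ≠ 1)) :
    ¬ Terminal I r y K w₁ w₂ := fun ht =>
  false_of_multi_sibling_joins H hT hSG hC₁ hpriv hidle hpart ht.2.2.2.2.2.2.1 (ht.2.2.2.2.2.2.2 e H.he)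

/-- **THE MULTI-SIBLING KILL, JOIN FORM — minimal cores (`TerminalNC`).** -/
theorem not_terminalNC_of_multi_sibling_joins {r : ℕ} (H : Setup I K w₁ w₂ e σ p S q) (hT : Typed I)
    (hSG : ∀ g ∈ w₂.2.1, ∀ g' ∈ w₂.2.1, g' ≠ g → ¬ ((I.vars g' 2 = I.vars g 2 ∧ I.vars g' 3 = I.vars g 3) ∨
      (I.vars g' 2 = I.vars g 3 ∧ I.vars g' 3 = I.vars g 2)))
    (hC₁ : ∀ v ∈ w₁.1, ∀ j ∈ K ∪ w₁.2.1, ¬ Through I v j)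
    (hpriv : ∀ j ∈ K ∪ w₁.2.1, ∃ a, Through I a j ∧ ∀ j' ∈ K ∪ w₁.2.1, Through I a j' → j' = j)
    (hidle : ∀ D ⊆ K, ∀ t : Bool, IsJoin I w₁.1 D t → (∀ j ∈ D, Through I σ j) → (t = true → ∀ g ∈ w₁.2.1, Through I σ g) →
      joinValue y w₁.2.2 D t ≠ 1)
    (hpart : ∀ g ∈ w₂.2.1, ∀ u v : Fin n, (v = p ∨ v = σ ∨ ∃ o ∈ S, v = q o) →
      ((I.vars g 2 = v ∧ I.vars g 3 = u) ∨ (I.vars g 2 = u ∧ I.vars g 3 = v)) → u ≠ p → u ≠ σ → (∀ o ∈ S, u ≠ q o) →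
      (∃ D ⊆ K.erase e, ∃ t : Bool, IsJoin I w₁.1 D t ∧ (∀ j ∈ D, Through I u j) ∧ (t = true → ∀ g' ∈ w₁.2.1, Through I u g') ∧
          joinValue y w₁.2.2 D t = 1) ∨
      (u ∉ w₁.1 ∧ (∀ j ∈ K, I.vars j 0 ≠ u ∧ I.vars j 1 ≠ u) ∧
        ∃ Z : Finset (Fin n), σ ∈ Z ∧ (∀ j ∈ K ∪ w₁.2.1, (I.vars j 2 = u → I.vars j 3 ∈ Z) ∧ (I.vars j 3 = u → I.vars j 2 ∈ Z)) ∧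
          (∀ w ∈ Z, ∀ j ∈ K, I.vars j 0 ≠ w ∧ I.vars j 1 ≠ w) ∧ (∀ w ∈ Z, w ∉ w₁.1) ∧
          ∀ D ⊆ K, ∀ t : Bool, IsJoin I w₁.1 D t → (∀ j ∈ D, Dead I Z j) → (t = true → ∀ g' ∈ w₁.2.1, Dead I Z g') →
            joinValue y w₁.2.2 D t ≠ 1)) :
    ¬ TerminalNC I r y K w₁ w₂ := fun ht =>
  false_of_multi_sibling_joins H hT hSG hC₁ hpriv hidle hpart ht.2.2.2.2.2.1 (ht.2.2.2.2.2.2 e H.he)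

/-- **The idle hypothesis is discharged when `σ` is UNTOUCHED by `Γ₂` and unpinned** — join form of `PstarMultiSiblingKill.false_of_untouched`:
no join through `σ` of value `1` and no monomial of `Γ₂` through the block ⇒ (T3) + (M0) at `e` contradictory. -/
theorem false_of_untouched_joins (H : Setup I K w₁ w₂ e σ p S q) (hT : Typed I)
    (hC₁ : ∀ v ∈ w₁.1, ∀ j ∈ K ∪ w₁.2.1, ¬ Through I v j)
    (hpriv : ∀ j ∈ K ∪ w₁.2.1, ∃ a, Through I a j ∧ ∀ j' ∈ K ∪ w₁.2.1, Through I a j' → j' = j)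
    (hidle : ∀ D ⊆ K, ∀ t : Bool, IsJoin I w₁.1 D t → (∀ j ∈ D, Through I σ j) → (t = true → ∀ g ∈ w₁.2.1, Through I σ g) →
      joinValue y w₁.2.2 D t ≠ 1)
    (huntouched : ∀ g ∈ w₂.2.1, ¬ Through I σ g ∧ ¬ Through I p g ∧ ∀ o ∈ S, ¬ Through I (q o) g)
    (hT3 : ¬ SatPair I y K w₁ w₂) (hM0 : SatPair I y (K.erase e) w₁ w₂) : False :=
  PstarMultiSiblingKill.false_of_untouched H huntouched (exists_idle_of_joins H hT hC₁ hpriv hidle) hT3 hM0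

end Summit.PneNP.PneNP.Theorems.PstarMultiSiblingJoins
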